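import Summits.PneNP.PneNP.Theorems.SzkEntropyPeaWorstToAvgReductions
import Summits.PneNP.PneNP.Theorems.SzkEntropyPeaWorstToAvgDualModeCard
import Summits.PneNP.PneNP.Theorems.PeaWorstToAvg.Negative.PeaWorstToAvgStrengthenings
import Literature.Computability.Complexity.RandomizingPolynomialsPerfect

/-!
# Line `dual-mode-compile` — skeleton for crux `SzkEntropy.PeaWorstToAvg` (stmt-PneNP-10777)

Crux (route `PneNP/SzkEntropy`, decl `Summit.PneNP.PneNP.Theses.SzkEntropy.PeaWorstToAvg`; named form
`Theorems.szkEntropy_peaWorstToAvg_iff`): `A → C` with `A := PEA 3 ∉ PromiseBPP'` and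
`C := ∃ D, D.IsPolySamplable ∧ (∀ n, supp Dₙ ⊆ (PEA 3).yes ∪ (PEA 3).no) ∧ ((PEA 3).yes, D) ∉ HeurBPP`.

Idea card `Cruxes/PeaWorstToAvg/Ideas/dual-mode-compile.md` (crux-ideate r1, ideator 1; triage r1: k1 pass ·
k2 fail (costume/socket) · k3 pass-with-doubt; merge advice: ride with `lossy-mode-compilation`, keep the
residual "hidden modes from worst-case hardness").  The card's LEVER — an indistinguishable, promise-separated,
samplable pair `K₀ ⊆ NO`, `K₁ ⊆ YES` makes the fair mixture `HeurBPP`-hard — is a tree THEOREM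
(`Theorems.not_mem_HeurBPP_of_isCompIndistinguishable`, `…_of_io_indistinguishable`, `conclusion_of_dualMode`,
`Ensemble.isPolySamplable_mixEnsemble`), so it is NOT a stub here.  The card's own transfer
"`A` ⇒ some certified dual-mode pair is (i.o.-)indistinguishable" is the crux with a strengthened conclusion
(triage r1-2: costume) and is NOT a stub either.  What this line files instead is the STRUCTURAL statement
behind it, of the worst-case/statistical kind the triage accepts (cf. `orbit-pair-rsr`'s C⁺ and
`lossy-mode-compilation`'s R1), on the Applebaum–Raykov axis `SRE` vs `SZK`:

* STUB 1 `stub_modeEncoding` (closing residual, research-level, HARDEST): `PEA 3` admits a MODE-PRESERVING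
  RANDOMIZED ENCODING onto a CERTIFIED DUAL-MODE PAIR of branching-program entropy instances — a `ModeKit`:
  two UNIFORM polynomial-time samplers `samp false`, `samp true` (honest polynomial coin budget) supported, at
  every parameter, on the NO resp. YES instances of `BPEA` (entropy approximation for affine parity branching
  programs, §1), and ONE uniform polynomial-time randomized map `enc` on instance strings whose output law on
  every YES (resp. NO) instance `x` of `PEA 3` is `1/16`-close in total variation to the law of `samp true`
  (resp. `samp false`) on `1^{|x|}`.  Informally: a statistical randomized encoding of `PEA₃` (Applebaum–Raykov
  2016) whose two simulators are certified samplers of `⊕`-branching-program keyed families — "hidden modes",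
  made unconditional and structural.  It is implied by `orbit-pair-rsr.stub_transfer` (Karp-reduce into two
  affine orbits, then re-randomise inside the orbit: an entropy-EXACT encoding onto ONE orbit per mode) but
  allows what that line cannot use: entropy-CHANGING encoders, target laws spread over many entropy classes,
  and targets in ANY log-space/`⊕L`-presented keyed family (number-theoretic, lattice, Goldreich/DUE-type local
  functions) — the AIK compile of STUB 2 brings them all back into `PEA 3`.
* STUB 2 `stub_compile` (L–XL, PROVABLE, the card's name): `BPEA ≤ₚ PEA 3` — entropy approximation for maps
  computed by affine parity branching programs Karp-reduces to cubic sparse maps, by the Ishai–Kushilevitz /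
  AIK PERFECT degree-3 randomizing polynomials of a branching program (`R₁ · L(x) · R₂` for the program's
  unit-subdiagonal matrix `L(x)`, canonical form depending on `det L(x)` only) and the exact entropy shift
  `H(p̂(U)) = H(f(U)) + |randomness|` (DGRV Thm. 4.5/4.6 in the general branching-program case; the tree's
  `RandomizingPolynomials*.lean` / `PEA_polyTimeReducible_PEA_three` do the PATH-program case only).  Also the
  missing ingredient named in `lattice-import-trapdoor-support.stub_certBDD_karp_to_pea`.
* STUB 3 `stub_adviceElim` (M–L, PROVABLE; same statement shape as `orbit-pair-rsr.stub_adviceElim`, one proof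
  serves both): a `HeurBPP` scheme (whose `RandAlg` coin budget is `O(log)` advice, Disproof §5 /
  `Theorems/SzkEntropyPeaWorstToAvgAdviceLeak.lean`) for a LABELLED mixture of two uniformly samplable
  certified components yields a UNIFORM scheme (`UHeurBPP`), by labelled self-testing of the candidate budgets.
* STUB 4 `stub_decider` (M–L, PROVABLE): a uniform scheme for `(BPEA.yes, ½K₀ + ½K₁)` plus a `ModeKit` decides
  `PEA 3` in `PromiseBPP'`: encode the input with `enc`, run the scheme at parameter `|x|` and failure `1/64`,
  majority over independent repetitions (per run: bad-set mass `≤ 2/64` under `K_b`, `+ 1/16` transport,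
  `+ 1/4` coin error: correct with probability `≥ 87/128 > 2/3`).

COMPOSITION `PeaWorstToAvg_of` (kernel-checked, no `sorry`): from `A` and the kit of STUB 1, the mixture of the
two certified laws is samplable (`Ensemble.isPolySamplable_mixEnsemble`) and on the promise of `BPEA`; were it
`HeurBPP`-easy it would be `UHeurBPP`-easy (STUB 3) and STUB 4 would put `PEA 3` in `PromiseBPP'`, contradicting
`A`; so `(BPEA.yes, mix) ∉ HeurBPP`, and STUB 2 with the landed push-forward
`Theorems.peaWorstToAvg_of_hard_reducible` (p71914) concludes the crux BY NAME.  §5 records the SOCKET role of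
the line (sorry-free modulo STUB 2): ANY computationally (or i.o.-) indistinguishable certified pair of `BPEA`
ensembles — QR / DDH / DCR / decision-LWE modes, orbit pairs, planted local functions — closes the crux outright.

DISPROOF.LEAN (gen 2, 2026-08-16) HONOURED: it has NO `_false_without_<H>` theorem and `-- Targets: none yet`, so
nothing is to be honoured by name; §1 (`not_peaWorstToAvg_iff`): the hypothesis `A` is USED, in the composition,
through STUB 4; §4 (`not_forall_ensembles`, `mem_HeurBPP_of_support_subset_no/_yes`, `exists_yes_and_no_of_hard`):
the hard ensemble is the ½/½ mixture of two CERTIFIED opposite-mode samplers — planted and two-sided by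
construction, never a re-randomisation of one map; §5 (advice asymmetry, `not_peaWorstToAvg_of_promiseScheme`):
budgeted explicitly as STUB 3 (uniform `PromiseBPP'` on the worst-case side, `coinLen`-advice on the `HeurBPP`
side); §3(b) (`detHyp_iff`): the `PromiseBPP'` hypothesis is kept as filed; §6 / `BarrierNotesIdeator2` B1–B2
(GL re-randomisation, direct sums/products and AIK re-encodings of ONE map are entropy-exact or leak the input
subspace): STUB 1 asks for an encoder that is NOT entropy-exact and whose target law is free — those dead
candidates are excluded by name in the line card, not re-proposed.  `ledger negatives --problem PneNP` (5 items):
none concerns PEA / branching programs; the BavardGap lesson (support conditions must be satisfiable at EVERY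
parameter) is met: `BPEA` has fixed YES and NO instances (`exists_mem_BPEA_yes/no`, §3).

Layout: §1 objects (definitions only — landed verbatim by the lead as the Theorems defs file
`Theorems/SzkEntropyPeaWorstToAvgDualModeCompileDefs.lean` so that stub proofs can state the registered signatures);
§2 the six stubs (`sorry` only there; LEAD RESHAPE 2026-08-16: `stub_compile` now takes the valuation-level
perfectness of one general Hessenberg block (`stub_blockPerf`, itself from the general Ishai–Kushilevitz canonical
form `stub_canon`, pure linear algebra) as a hypothesis — three mutually independent provable pieces); §3 sorry-free
glue; §4 the composition `PeaWorstToAvg_of`; §5 the socket theorems (reach of the line).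

References: Dvir–Gutfreund–Rothblum–Vadhan, ECCC TR10-160 / ICS 2011, Thm. 1.1, Thm. 4.5–4.6, pp. 2–3
[DvirGutfreundRothblumVadhan2010]; Ishai–Kushilevitz, ICALP 2002, §3 [IshaiKushilevitz2002];
Applebaum–Ishai–Kushilevitz, SICOMP 36 (2006), §4 [ApplebaumIshaiKushilevitz2006]; Applebaum–Raykov, *On the
relationship between statistical zero-knowledge and statistical randomized encodings*, CRYPTO 2016 Part III,
pp. 449–477, doi:10.1007/978-3-662-53015-3_16, Thm. 1 (`SRE ⊆ 1RE = NISZK^pub ⊆ SZK`), Thm. 3 (`SRE ⊄ BPP ⇒`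
i.o.-OWF) — READ at page level this session [ApplebaumRaykov2016]; Peikert–Waters, STOC 2008
(lossy / dual-mode families) [PeikertWaters2008]; Bogdanov–Trevisan, FnT-TCS 2006, Def. 2.1, 2.12–2.13,
Lemma 3.2 [BogdanovTrevisan2006]; Goldreich 2001, Def. 3.2.2 [Goldreich2001]; Goldreich 2006, Def. 1.2, 1.4
[Goldreich2006]; Feigenbaum–Fortnow 1993 (random self-reducibility) [FeigenbaumFortnow1993];
Bitansky–Degwekar–Vaikuntanathan 2021 (no black-box SZK hardness from OWF) [BitanskyDegwekarVaikuntanathan2021].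
-/

noncomputable section

set_option linter.dupNamespace false

namespace Summit.PneNP.PneNP.Cruxes.PeaWorstToAvg.DualModeCompile

open Literature.Computability.Complexity Literature.Computability.MetaComplexity
open Literature.Computability.Cryptography (IsCompIndistinguishable IsPPT distAdvantage)
open Literature.InformationTheory.Entropy (mapEntropy)
open _root_.Computability
open Summit.PneNP.PneNP.Theorems

/-! ## §1 Objects of the line -/

/-- An AFFINE LABEL over `ℓ` input bits: a constant bit and a list of variable indices; its value at
`x ∈ F₂^ℓ` is `c + Σ_{i ∈ S} xᵢ` (repetitions cancel in pairs).  Ordinary branching-program labels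
`1`, `xᵢ`, `¬xᵢ = 1 + xᵢ` are the cases `|S| ≤ 1`. [IshaiKushilevitz2002, §3] -/
abbrev AffLabel (ℓ : ℕ) : Type := Bool × List (Fin ℓ)

namespace AffLabel

/-- Value of an affine label at an input. -/
def eval {ℓ : ℕ} (a : AffLabel ℓ) (x : Fin ℓ → ZMod 2) : ZMod 2 :=
  (if a.1 then 1 else 0) + (a.2.map x).sum

end AffLabel

/-- An AFFINE PARITY BRANCHING PROGRAM on `ℓ` input bits (sparse presentation): nodes `0, …, N` with
`N = P.length`, source `0`, sink `N`; row `i` lists the labels of the edges `i → i+1, i → i+2, …`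
(missing entries: label `0`, i.e. no edge).  Its value is the number modulo `2` of source-to-sink paths,
weighted by the product of the edge labels — every `⊕L` / deterministic-logspace keyed function has
polynomial-size such programs (one per output bit). [IshaiKushilevitz2002, §3; ApplebaumIshaiKushilevitz2006, §4] -/
abbrev AffBP (ℓ : ℕ) : Type := List (List (AffLabel ℓ))

namespace AffBP

variable {ℓ : ℕ}

/-- The label of the edge from node `i` to node `j + 1` (meaningful for `i ≤ j`; default `0`). -/
def label (P : AffBP ℓ) (i j : ℕ) : AffLabel ℓ :=
  (P.getD i []).getD (j - i) (false, [])

/-- **The Ishai–Kushilevitz matrix** `L(x)` of the program at input `x`: rows = nodes `0 … N-1`,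
columns = nodes `1 … N`; entry `(i, j)` = value of the label of the edge `i → j+1` for `i ≤ j`, `1` on the
subdiagonal (`i = j + 1`; `-1 = 1` over `F₂`), `0` below it.  [IshaiKushilevitz2002, §3 (the matrix `L(x)`)] -/
def mat (P : AffBP ℓ) (x : Fin ℓ → ZMod 2) : Matrix (Fin P.length) (Fin P.length) (ZMod 2) :=
  Matrix.of fun i j =>
    if i.val ≤ j.val then (P.label i.val j.val).eval x else if i.val = j.val + 1 then 1 else 0

/-- **Value of the program** at `x`: `det L(x)` = the weighted number of source-to-sink paths mod `2`
(expansion of the unit-lower-Hessenberg determinant). [IshaiKushilevitz2002, §3] -/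
def eval (P : AffBP ℓ) (x : Fin ℓ → ZMod 2) : ZMod 2 :=
  (P.mat x).det

end AffBP

/-- A multi-output affine parity branching program on `ℓ` input bits: one program per output bit. -/
abbrev AffBPMap (ℓ : ℕ) : Type := List (AffBP ℓ)

namespace AffBPMap

variable {ℓ : ℕ}

/-- The output word at `x`. -/
def eval (F : AffBPMap ℓ) (x : Fin ℓ → ZMod 2) : List (ZMod 2) :=
  F.map fun P => P.eval x

/-- **Output entropy** `H(F(U_ℓ))` in bits of the map on a uniform input (`mapEntropy`, as for
`PolyMapF2.entropy`). [DvirGutfreundRothblumVadhan2010, Def. 2.1] -/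
def entropy (F : AffBPMap ℓ) : ℝ :=
  mapEntropy Finset.univ F.eval

/-- Boolean encoding of multi-output affine programs on `ℓ` inputs (labels: bit paired with a list of
variable indices in binary; nested self-delimiting lists — the combinators of `PEAInst.encoding`). -/
def encoding (ℓ : ℕ) : Encoding (AffBPMap ℓ) Bool :=
  ((encodingBoolBool.pairBool (encodingFinBool ℓ).listBool).listBool.listBool).listBool

end AffBPMap

/-- Instances of `BPEA`: number of input bits `ℓ`, a multi-output affine parity branching program on
`ℓ` bits, an integer entropy threshold `k`. -/
abbrev BPEAInst : Type := Σ ℓ : ℕ, AffBPMap ℓ × ℕ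

/-- Boolean encoding of `BPEA` instances: `ℓ` in binary, then the program paired with `k` in binary. -/
def BPEAInst.encoding : Encoding BPEAInst Bool :=
  Encoding.sigmaBool fun ℓ => (AffBPMap.encoding ℓ).pairBool encodingNatBool

/-- **`BPEA` — Branching-Program Entropy Approximation** (gap `1` at integer thresholds, the convention of
`PEA`): on `(F, k)` with `F` a multi-output affine parity branching program, YES iff `H(F(U_ℓ)) ≥ k + 1`,
NO iff `H(F(U_ℓ)) ≤ k`.  This is Entropy Approximation [GoldreichSahaiVadhan1999] for `⊕`-branching-program
samplers — the format in which EVERY logspace keyed family (QR, DDH, DCR, LWE modes; Goldreich/DUE local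
functions; affine orbits of cubic maps) presents its two modes, and the SOURCE of the AIK compile `BPEA ≤ₚ PEA 3`
(`stub_compile`). [DvirGutfreundRothblumVadhan2010, Thm. 4.5–4.6; ApplebaumIshaiKushilevitz2006, §4] -/
def BPEA : PromiseProblem :=
  PromiseProblem.ofEncoding BPEAInst.encoding
    {I | (I.2.2 : ℝ) + 1 ≤ AffBPMap.entropy I.2.1}
    {I | AffBPMap.entropy I.2.1 ≤ (I.2.2 : ℝ)}

/-- `UHeurBPP`: randomized heuristic schemes (Bogdanov–Trevisan Def. 2.12–2.13, the tree's `HeurBPP`) whose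
coin budget is an honest polynomial of the input length — the UNIFORM sub-class (the tree's `RandAlg.coinLen`
is an arbitrary polynomially bounded function, i.e. `O(log)` advice; Disproof §5,
`Theorems/SzkEntropyPeaWorstToAvgAdviceLeak.lean`).  Verbatim the notion of `Lines/orbit-pair-rsr.lean`.
[BogdanovTrevisan2006, Def. 2.12–2.13; AroraBarak2009, §6.3] -/
def UHeurBPP : Set DistProblem :=
  {Q | ∃ A : RandAlg (List Bool × ℕ × ℕ) Bool, A.IsPolyTime schemeEnc encodeBool ∧
    (∃ c : Polynomial ℕ, ∀ ℓ, A.coinLen ℓ = c.eval ℓ) ∧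
    ∀ n m : ℕ, 0 < m →
      Q.dist.prob n {x | 1 / 4 ≤ A.pr schemeEnc (x, n, m) {b | b ≠ Q.lang.boolIndicator x}} ≤ 1 / m}

/-- **Mode kit** — the object asserted by the closing stub.  A CERTIFIED DUAL-MODE PAIR of branching-program
samplers plus a MODE-PRESERVING RANDOMIZED ENCODING of `PEA 3` onto it:
* `samp b` (`b = false/true`): UNIFORM polynomial-time samplers (honest polynomial coin budget `sampCoins`)
  whose output on `1ⁿ` is, for EVERY coin outcome and every `n`, a NO (resp. YES) instance of `BPEA`
  — the "lossy" and the "injective" mode, certified BY THE SAMPLER (syntactically / by trapdoor / by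
  construction), never by inspecting the instance;
* `enc`: ONE uniform polynomial-time randomized map on strings (coin budget `encCoins`) such that for every
  YES instance `x` of `PEA 3` the law of `enc x` is `1/16`-close, on every event, to the law of `samp true` on
  `1^{|x|}`, and for every NO instance to that of `samp false` (one-sided event bounds over all events =
  total variation `≤ 1/16`).
So `enc` is a statistical randomized encoding of the promise problem `PEA 3` whose two simulators are the
certified mode samplers; it need NOT preserve entropy and it NEED NOT land on the promise for every coin
(off-law outputs are charged to the `1/16`). [ApplebaumRaykov2016, Def. of `SRE`, Thm. 3;
PeikertWaters2008 (dual-mode families); FeigenbaumFortnow1993 (random self-reductions)] -/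
structure ModeKit where
  /-- certified sampler of mode `b` on input `1ⁿ` -/
  samp : Bool → RandAlg ℕ (List Bool)
  samp_polyTime : ∀ b, (samp b).IsPolyTime unaryEncodeNat (id : List Bool → List Bool)
  /-- its coin budget is this polynomial of the input length (uniformity) -/
  sampCoins : Polynomial ℕ
  samp_coinLen : ∀ b ℓ, (samp b).coinLen ℓ = sampCoins.eval ℓ
  samp_no : ∀ n, ∀ w ∈ ((samp false).outputPMF unaryEncodeNat n).support, w ∈ BPEA.no
  samp_yes : ∀ n, ∀ w ∈ ((samp true).outputPMF unaryEncodeNat n).support, w ∈ BPEA.yes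
  /-- the mode-preserving randomized encoder on instance strings -/
  enc : RandAlg (List Bool) (List Bool)
  enc_polyTime : enc.IsPolyTime (id : List Bool → List Bool) (id : List Bool → List Bool)
  encCoins : Polynomial ℕ
  enc_coinLen : ∀ ℓ, enc.coinLen ℓ = encCoins.eval ℓ
  enc_yes : ∀ x ∈ (PEA 3).yes, ∀ E : Set (List Bool),
    enc.pr id x E ≤ (samp true).pr unaryEncodeNat x.length E + 1 / 16
  enc_no : ∀ x ∈ (PEA 3).no, ∀ E : Set (List Bool),
    enc.pr id x E ≤ (samp false).pr unaryEncodeNat x.length E + 1 / 16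

namespace ModeKit

/-- The certified law of mode `b`: `n ↦` law of `samp b` on `1ⁿ`. -/
def law (kit : ModeKit) (b : Bool) : Ensemble := fun n => (kit.samp b).outputPMF unaryEncodeNat n

/-- The hard ensemble of the line: the fair mixture of the two certified laws. -/
def mix (kit : ModeKit) : Ensemble := mixEnsemble (kit.law false) (kit.law true)

end ModeKit

/-- Entry `(i, k)` of the symbolic product `R₁ · L · R₂` for a SYMBOLIC `(d+1) × (d+1)` matrix `Lsym` (entry `(j, l)` a
sparse polynomial `Lsym j l`), with the tree's symbolic randomizers `RandPoly.symR1` / `RandPoly.symR2`; for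
`Lsym = RandPoly.symL T ρ d` this is `RandPoly.entry n₀ T ρ d i k`. [IshaiKushilevitz2002, §3] -/
def entryOf (n₀ d : ℕ) (Lsym : ℕ → ℕ → List (List ℕ)) (i k : ℕ) : List (List ℕ) :=
  (List.range (d + 1)).flatMap fun j => (List.range (d + 1)).flatMap fun l =>
    RandPoly.mulP (RandPoly.mulP (RandPoly.symR1 n₀ i j) (Lsym j l)) (RandPoly.symR2 n₀ d l k)

/-- **The degree-3 block** of a symbolic Hessenberg matrix: the entries `(i, k)`, `i ≤ k ≤ d`, of `R₁ · Lsym · R₂`,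
fresh variables numbered from `n₀` (`RandPoly.pos d d` of them); for `Lsym = RandPoly.symL T ρ (|T|-1)` this is
`RandPoly.ikBlock n₀ T ρ`. [IshaiKushilevitz2002, §3; ApplebaumIshaiKushilevitz2006, §4.2] -/
def blockOf (n₀ d : ℕ) (Lsym : ℕ → ℕ → List (List ℕ)) : List (List (List ℕ)) :=
  (RandPoly.pairsLE d).map fun ik => entryOf n₀ d Lsym ik.1 ik.2

/-! ### The four statements of the line (readable names; the stubs of §2 state them verbatim) -/

/-- Statement of STUB 1: a mode kit exists. -/
abbrev ModeEncodingStmt : Prop := Nonempty ModeKit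

/-- Statement of STUB 2: the AIK compile `BPEA ≤ₚ PEA 3` (from the canonical form). -/
abbrev CompileStmt : Prop := BPEA.PolyTimeReducible (PEA 3)

/-- Statement of STUB 3: advice elimination for labelled certified mixtures. -/
abbrev AdviceElimStmt : Prop :=
  ∀ (Q : PromiseProblem), Q.Disjoint → ∀ (S : Bool → RandAlg ℕ (List Bool)),
    (∀ b, (S b).IsPolyTime unaryEncodeNat (id : List Bool → List Bool)) →
    ∀ c : Polynomial ℕ, (∀ b ℓ, (S b).coinLen ℓ = c.eval ℓ) →
    (∀ n, ∀ w ∈ ((S false).outputPMF unaryEncodeNat n).support, w ∈ Q.no) →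
    (∀ n, ∀ w ∈ ((S true).outputPMF unaryEncodeNat n).support, w ∈ Q.yes) →
    (⟨Q.yes, mixEnsemble (fun n => (S false).outputPMF unaryEncodeNat n)
        (fun n => (S true).outputPMF unaryEncodeNat n)⟩ : DistProblem) ∈ HeurBPP →
    (⟨Q.yes, mixEnsemble (fun n => (S false).outputPMF unaryEncodeNat n)
        (fun n => (S true).outputPMF unaryEncodeNat n)⟩ : DistProblem) ∈ UHeurBPP

/-- Statement of STUB 4: the encoded decider. -/
abbrev DeciderStmt : Prop :=
  ∀ kit : ModeKit, (⟨BPEA.yes, kit.mix⟩ : DistProblem) ∈ UHeurBPP → PEA 3 ∈ PromiseBPP'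

/-! ## §2 The stubs (`sorry` lives only here) -/

/-- **STUB 1 · `stub_modeEncoding`** (closing residual; research-level, OPEN — HARDEST; the lead holds it).
`PEA 3` has a mode-preserving randomized encoding onto a certified dual-mode pair of branching-program
entropy instances (`ModeKit`): "hidden modes" in STATISTICAL, unconditional form — `PEA₃ ∈ SRE` with certified
`⊕`-BP simulators (Applebaum–Raykov).  Why it might fail: it puts `SZKP_L` inside `SRE ⊆ SZK` (open; by
Applebaum–Raykov Thm. 3 it yields i.o.-OWF from `SZKP_L ⊄ BPP`), and the encoder must EQUALISE the law of all
YES (resp. NO) instances of a length modulo the mode without computing entropies — entropy-exact moves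
(GL/affine re-randomisation, direct sums/products, AIK re-encoding of one map) provably cannot (Disproof §6,
barrier notes B1–B2); an instance-hiding gadget for cubic maps is not known.  Implied by
`orbit-pair-rsr.stub_transfer`; implies the card's transfer `A ⇒` i.o.-indistinguishable certified pair.
[ApplebaumRaykov2016, Thm. 3; DvirGutfreundRothblumVadhan2010, pp. 2–3; FeigenbaumFortnow1993] -/
theorem stub_modeEncoding : Nonempty ModeKit := by
  sorry

/-- **STUB 2 · `stub_compile`** (L–XL, PROVABLE — the AIK compile, FROM the one-block perfectness `hblock` =
statement of `stub_blockPerf`).  `BPEA ≤ₚ PEA 3`: on `⟨ℓ, (F, k)⟩` output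
`⟨ℓ + s, (p̂, k + s)⟩` where, for each output program `P` of `F` with matrix `L_P(x)` (`AffBP.mat`), `p̂`
lists the entries on and above the diagonal of `R₁ · L_P(x) · R₂` with `R₁` a generic upper unitriangular and
`R₂` a generic "last column" matrix in FRESH variables (`RandPoly.IsUnitri` / `IsLastCol`), `s` = number of
fresh variables: every entry is a sparse polynomial of degree `≤ 3` with `O(N²)` monomials; for every `x`
the randomization is a bijection between randomness and matrices of canonical form `C_{det L_P(x)}`
(Ishai–Kushilevitz canonical-form lemma for unit-lower-Hessenberg matrices — the tree proves the path-matrix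
case, `RandomizingPolynomialsCanon.lean`), hence PERFECT: `H(p̂(U_{ℓ+s})) = H(F(U_ℓ)) + s` exactly, YES ↦ YES
and NO ↦ NO at the shifted integer threshold; the instance map is one `FP` function on codes (as
`codeFP_reduceRaw` in `PEADegreeReduction.lean`). [IshaiKushilevitz2002, §3; ApplebaumIshaiKushilevitz2006,
§4.2; DvirGutfreundRothblumVadhan2010, Thm. 4.5–4.6; Goldreich2006, Def. 1.4] -/
theorem stub_compile
    (hblock : ∀ (n₀ d : ℕ) (Lsym : ℕ → ℕ → List (List ℕ)),
      (∀ j l : ℕ, j = l + 1 → Lsym j l = [[]]) →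
      (∀ j l : ℕ, l + 1 < j → Lsym j l = []) →
      (∀ j l : ℕ, j ≤ l → ∀ μ ∈ Lsym j l, ∀ x ∈ μ, x < n₀) →
      RandPoly.PerfExt n₀ (n₀ + RandPoly.pos d d) (blockOf n₀ d Lsym)
        (fun v => (Matrix.of fun (j l : Fin (d + 1)) => RandPoly.evalP v (Lsym j.val l.val)).det)) :
    BPEA.PolyTimeReducible (PEA 3) := by
  sorry

/-- **STUB 2a · `stub_canon`** (M–L, PROVABLE — lead's reshape of STUB 2, pure linear algebra).  The general
Ishai–Kushilevitz canonical form: for every unit-lower-Hessenberg `L` (subdiagonal `1`, zero below it, arbitrary on and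
above the diagonal) there are `A` upper unitriangular (`RandPoly.IsUnitri`) and `B = 1 + (last column above the
diagonal)` (`RandPoly.IsLastCol`) with `A * L * B = RandPoly.canon L.det`.  Proof: clear the entries on/above the
diagonal in columns `0 … d-1` by adding LOWER rows (row `j+1` has its subdiagonal `1` in column `j` and zeros to the
left) — an upper unitriangular row operation —, then clear rows `1 … d` of the last column by adding the columns
`0 … d-1` (now unit vectors) to it — a last-column operation; the surviving corner entry is `det L` (expand; over `F₂`
no signs).  Equivalently: `(A, B) ↦ A · canon δ · B` is injective (tree `RandPoly.eq_of_proj_canon_eq`) from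
`Unitri × LastCol` (`2^{d(d+1)/2} · 2^d` elements) into the unit-lower-Hessenberg matrices of determinant `δ`
(`2^{(d+1)(d+2)/2 - 1}` elements) — equal counts.  STUB 2 consumes it exactly as the path case consumes
`RandPoly.pathMat_eq`.  (Stated spelled-out, with no `Prop` abbreviation, so that the landed stub files match the
registered signatures literally.) [IshaiKushilevitz2002, §3 (Lemma 1 and its proof); ApplebaumIshaiKushilevitz2006, §4.2, Fact 4.6] -/
theorem stub_canon :
    ∀ (d : ℕ) (L : RandPoly.Mat d),
      (∀ i j : Fin (d + 1), i.val = j.val + 1 → L i j = 1) →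
      (∀ i j : Fin (d + 1), j.val + 1 < i.val → L i j = 0) →
      ∃ A B : RandPoly.Mat d, RandPoly.IsUnitri A ∧ RandPoly.IsLastCol B ∧ A * L * B = RandPoly.canon L.det := by
  sorry

/-- **STUB 2b · `stub_blockPerf`** (M–L, PROVABLE — lead's reshape of STUB 2; the valuation-level perfectness of ONE
block, from the canonical form).  For a SYMBOLIC unit-lower-Hessenberg matrix `Lsym` (entry `(j, l)`: the constant
polynomial `1 = [[]]` on the subdiagonal `j = l + 1`, the zero polynomial `[]` below it, affine or arbitrary sparse
polynomials in variables `< n₀` on and above the diagonal), the block `blockOf n₀ d Lsym` (entries `i ≤ k` of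
`R₁ · Lsym · R₂` with the tree's symbolic randomizers `RandPoly.symR1/symR2` in the fresh variables
`[n₀, n₀ + pos d d)`) is a PERFECT EXTENSION (`RandPoly.PerfExt`: injective on the fresh variables, outputs decode
the target, output set over a fixed prefix depends only on the target) of the target
`v ↦ det (Lsym evaluated at v)`.  Proof = the tree's `RandPoly.perfExt_ikBlock` with `pathMat` replaced by a general
Hessenberg `L(v)`: `evalP (entryOf …) = (matR1 v * L(v) * matR2 v) i k` (as `RandPoly.evalP_entry`); write
`L(v) = A⁻¹ · canon δ · B` by the canonical form (`hcanon`; `B⁻¹ = B` by `IsLastCol.mul_self`, `A⁻¹` unitriangular),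
so `R₁ L R₂ = (R₁A⁻¹) · canon δ · (B R₂)` with `(R₁, R₂) ↦ (R₁A⁻¹, BR₂)` a bijection of `Unitri × LastCol`
(`IsUnitri.mul`, `IsLastCol.mul`); then injectivity and decoding are the tree's `RandPoly.eq_of_proj_canon_eq` /
`pathVal_eq_of_proj_eq` (`canon δ = pathMat 0 δ`, `pathVal 0 δ = δ`), and the range clause realises the required
`(A', B')` by a valuation as in `perfExt_ikBlock`; `det (canon δ) = δ` by Laplace expansion along row `0`
(`Matrix.det_succ_row_zero`, unit lower-triangular minor). [IshaiKushilevitz2002, §3; ApplebaumIshaiKushilevitz2006,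
§4.2, Fact 4.6 and Lemma 4.9] -/
theorem stub_blockPerf
    (hcanon : ∀ (d : ℕ) (L : RandPoly.Mat d),
      (∀ i j : Fin (d + 1), i.val = j.val + 1 → L i j = 1) →
      (∀ i j : Fin (d + 1), j.val + 1 < i.val → L i j = 0) →
      ∃ A B : RandPoly.Mat d, RandPoly.IsUnitri A ∧ RandPoly.IsLastCol B ∧ A * L * B = RandPoly.canon L.det) :
    ∀ (n₀ d : ℕ) (Lsym : ℕ → ℕ → List (List ℕ)),
      (∀ j l : ℕ, j = l + 1 → Lsym j l = [[]]) →
      (∀ j l : ℕ, l + 1 < j → Lsym j l = []) →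
      (∀ j l : ℕ, j ≤ l → ∀ μ ∈ Lsym j l, ∀ x ∈ μ, x < n₀) →
      RandPoly.PerfExt n₀ (n₀ + RandPoly.pos d d) (blockOf n₀ d Lsym)
        (fun v => (Matrix.of fun (j l : Fin (d + 1)) => RandPoly.evalP v (Lsym j.val l.val)).det) := by
  sorry

/-- **STUB 3 · `stub_adviceElim`** (L, PROVABLE — advice elimination by labelled self-testing; statement
shape shared verbatim with `orbit-pair-rsr.stub_adviceElim`, one proof serves both lines).  If the two
components of a fair mixture are sampled by UNIFORM samplers and lie inside the NO resp. YES side of a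
disjoint promise problem (so samples come LABELLED), every advice-taking heuristic scheme `A` for
`(Q.yes, mixture)` yields a uniform one `U(y, 1ⁿ, 1ᵐ)`: pad the failure parameter of EVERY query `y'` (the
input and the test samples alike) to `m'(y') = G(n, m) − 2|y'| − 2n − 4`, so that all padded queries have the
same length `G(n, m)` and hence ONE unknown budget `c* = coinLen_A(G) ≤ p_A(G)` (the device of the tree's
`exists_padded_simulator`; bad mass `Σ_j 1/m'_j ≤ 1/(64m)`); enumerate the candidates `c ≤ p_A(G)`, estimate
each majority-amplified candidate's labelled error on `N = O(m² log(m·p_A(G)))` fresh samples `(b, S_b(1ⁿ))`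
(Hoeffding), and run the first candidate with empirical error `≤ 3/(64m)` — the true budget passes, and by
Markov any passing candidate has bad-set mass `≤ 1/(2m)`; `U` reads an honest polynomial number of coins.
[BogdanovTrevisan2006, Def. 2.12–2.13 and Lemma 3.2; AroraBarak2009, §6.3, Thm. 7.10] -/
theorem stub_adviceElim (Q : PromiseProblem) (hQ : Q.Disjoint) (S : Bool → RandAlg ℕ (List Bool))
    (hS : ∀ b, (S b).IsPolyTime unaryEncodeNat (id : List Bool → List Bool))
    (c : Polynomial ℕ) (hc : ∀ b ℓ, (S b).coinLen ℓ = c.eval ℓ)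
    (h₀ : ∀ n, ∀ w ∈ ((S false).outputPMF unaryEncodeNat n).support, w ∈ Q.no)
    (h₁ : ∀ n, ∀ w ∈ ((S true).outputPMF unaryEncodeNat n).support, w ∈ Q.yes)
    (h : (⟨Q.yes, mixEnsemble (fun n => (S false).outputPMF unaryEncodeNat n)
        (fun n => (S true).outputPMF unaryEncodeNat n)⟩ : DistProblem) ∈ HeurBPP) :
    (⟨Q.yes, mixEnsemble (fun n => (S false).outputPMF unaryEncodeNat n)
        (fun n => (S true).outputPMF unaryEncodeNat n)⟩ : DistProblem) ∈ UHeurBPP := by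
  sorry

/-- **STUB 4 · `stub_decider`** (M–L, PROVABLE — the encoded decider).  A uniform heuristic scheme `A` for
`(BPEA.yes, ½K₀ + ½K₁)` (the kit's certified laws) decides `PEA 3` in textbook `PromiseBPP'`: on `x`, repeat
`t = 9` times independently — draw `y ← enc x`, run `A(y, 1^{|x|}, 1^{64})` with its (polynomial, hence
computable) coin budget — and output the majority.  Per run, on a YES instance: the bad set of `A` has
mixture-mass `≤ 1/64`, hence `K₁`-mass `≤ 1/32` (`toOuterMeasure_le_two_mul_mixEnsemble`); off-support strings
have `K₁`-mass `0`; by `enc_yes` the draw `y` avoids both except with probability `≤ 1/32 + 1/16`, and then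
`y ∈ BPEA.yes` (certificate `samp_yes`) so `A` answers `true` with probability `> 3/4`: success `≥ 87/128`;
symmetrically on NO instances (`BPEA` is disjoint, `BPEA_disjoint`).  The coin string of the `PromiseBPP'`
machine is the fixed polynomial `t · (encCoins(|x|) + c_A(poly(|x|)))`, read by prefixes; the predicate
`(x, coins) ↦ answer` is in `P`. [Goldreich2006, Def. 1.2; AroraBarak2009, Def. 7.3, Thm. 7.10;
BogdanovTrevisan2006, Def. 2.12] -/
theorem stub_decider (kit : ModeKit) (h : (⟨BPEA.yes, kit.mix⟩ : DistProblem) ∈ UHeurBPP) :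
    PEA 3 ∈ PromiseBPP' := by
  sorry

/-! ## §3 Glue (sorry-free) -/

/-- `BPEA` is a disjoint promise problem (`k + 1 ≤ H` and `H ≤ k` are incompatible; encodings are injective). -/
theorem BPEA_disjoint : BPEA.Disjoint := by
  refine PromiseProblem.disjoint_ofEncoding _ (Set.disjoint_left.2 fun I hY hN => ?_)
  simp only [Set.mem_setOf_eq] at hY hN
  linarith

/-- Uniform schemes are schemes: `UHeurBPP ⊆ HeurBPP`. -/
theorem UHeurBPP_subset_HeurBPP : UHeurBPP ⊆ HeurBPP := by
  rintro Q ⟨A, hA, -, hbad⟩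
  exact ⟨A, hA, hbad⟩

/-- The empty program list on `0` inputs with threshold `0` is a NO instance of `BPEA` (`H = 0 ≤ 0`):
the NO side is inhabited at every parameter (cf. the BavardGap negative: support conditions must be
satisfiable at every `n`). -/
theorem exists_mem_BPEA_no : BPEAInst.encoding.encode ⟨0, ([], 0)⟩ ∈ BPEA.no := by
  refine (BPEAInst.encoding.mem_toLanguage_iff _ _).2 ?_
  show AffBPMap.entropy ([] : AffBPMap 0) ≤ ((0 : ℕ) : ℝ)
  have h : AffBPMap.eval ([] : AffBPMap 0) = fun _ => [] := by
    funext x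
    simp [AffBPMap.eval]
  rw [AffBPMap.entropy, h, Literature.InformationTheory.Entropy.mapEntropy_const]
  simp

/-- The one-edge program `x₀` on `1` input with threshold `0` is a YES instance of `BPEA` (`H = 1 ≥ 0 + 1`):
the YES side is inhabited too. -/
theorem exists_mem_BPEA_yes :
    BPEAInst.encoding.encode ⟨1, ([[[((false, [0]) : AffLabel 1)]]], 0)⟩ ∈ BPEA.yes := by
  refine (BPEAInst.encoding.mem_toLanguage_iff _ _).2 ?_
  show ((0 : ℕ) : ℝ) + 1 ≤ AffBPMap.entropy ([[[((false, [0]) : AffLabel 1)]]] : AffBPMap 1)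
  have hev : AffBPMap.eval ([[[((false, [0]) : AffLabel 1)]]] : AffBPMap 1) = fun x => [x 0] := by
    funext x
    simp [AffBPMap.eval, AffBP.eval, AffBP.mat, AffBP.label, AffLabel.eval, Matrix.det_unique]
  have hinj : Function.Injective (AffBPMap.eval ([[[((false, [0]) : AffLabel 1)]]] : AffBPMap 1)) := by
    rw [hev]
    intro x y hxy
    funext i
    fin_cases i
    simpa using hxy
  have hH := Literature.InformationTheory.Entropy.mapEntropy_of_injective
    (Finset.univ : Finset (Fin 1 → ZMod 2)) hinj
  rw [AffBPMap.entropy, hH]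
  simp

namespace ModeKit

variable (kit : ModeKit)

/-- The certified laws are polynomial-time samplable (by their very samplers). -/
theorem isPolySamplable_law (b : Bool) : (kit.law b).IsPolySamplable :=
  ⟨kit.samp b, kit.samp_polyTime b, fun _ => rfl⟩

/-- The mixture is polynomial-time samplable (tree: `Ensemble.isPolySamplable_mixEnsemble`, p70907). -/
theorem isPolySamplable_mix : kit.mix.IsPolySamplable :=
  Ensemble.isPolySamplable_mixEnsemble (kit.isPolySamplable_law false) (kit.isPolySamplable_law true)

/-- The certified law of mode `false` lives on NO instances of `BPEA`. -/
theorem law_false_support (n : ℕ) (w : List Bool) (hw : w ∈ (kit.law false n).support) : w ∈ BPEA.no :=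
  kit.samp_no n w hw

/-- The certified law of mode `true` lives on YES instances of `BPEA`. -/
theorem law_true_support (n : ℕ) (w : List Bool) (hw : w ∈ (kit.law true n).support) : w ∈ BPEA.yes :=
  kit.samp_yes n w hw

/-- The mixture is supported on the promise of `BPEA` (tree: `mixEnsemble_support_subset_promise`). -/
theorem mix_support (n : ℕ) (w : List Bool) (hw : w ∈ (kit.mix n).support) :
    w ∈ BPEA.yes ∨ w ∈ BPEA.no :=
  mixEnsemble_support_subset_promise kit.law_false_support kit.law_true_support n w hw

/-- **Consistency with the landed Negative lemma** `Theorems.pea_exists_yes_and_no_of_not_mem_HeurBPP`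
(`Theorems/PeaWorstToAvg/Negative/PeaWorstToAvgStrengthenings.lean`: a hard on-promise ensemble must charge
BOTH sides; one-sided ensembles are easy): the kit's mixture charges a YES and a NO instance of `BPEA` at EVERY
parameter, by construction (each certified law has non-empty support). -/
theorem mix_charges_both (n : ℕ) :
    (∃ w ∈ (kit.mix n).support, w ∈ BPEA.yes) ∧ (∃ w ∈ (kit.mix n).support, w ∈ BPEA.no) := by
  obtain ⟨w₁, hw₁⟩ := (kit.law true n).support_nonempty
  obtain ⟨w₀, hw₀⟩ := (kit.law false n).support_nonempty
  exact ⟨⟨w₁, (mem_support_mixEnsemble_iff _ _ n w₁).2 (Or.inr hw₁), kit.law_true_support n w₁ hw₁⟩,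
    ⟨w₀, (mem_support_mixEnsemble_iff _ _ n w₀).2 (Or.inl hw₀), kit.law_false_support n w₀ hw₀⟩⟩

/-- Each certified law is dominated by twice the mixture (tree: `toOuterMeasure_le_two_mul_mixEnsemble`). -/
theorem law_le_two_mul_mix (b : Bool) (n : ℕ) (E : Set (List Bool)) :
    (kit.law b n).toOuterMeasure E ≤ 2 * (kit.mix n).toOuterMeasure E := by
  have h := toOuterMeasure_le_two_mul_mixEnsemble (kit.law false) (kit.law true) n E b
  cases b <;> simpa [ModeKit.mix] using h

end ModeKit

/-! ## §4 Composition -/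

/-- **The line on `BPEA`.** From STUB 1, STUB 3, STUB 4 (as statements) and the crux's hypothesis
`A : PEA 3 ∉ PromiseBPP'`: the mixture of the kit's certified laws is a polynomial-time samplable ensemble on
the promise of `BPEA` on which `BPEA.yes` is `HeurBPP`-hard — else advice elimination and the encoded decider
put `PEA 3` in `PromiseBPP'`. [BogdanovTrevisan2006, Def. 2.12–2.13; ApplebaumRaykov2016, Thm. 3 (shape)] -/
theorem bpea_hard_of_parts (hE : ModeEncodingStmt) (hA : AdviceElimStmt) (hD : DeciderStmt)
    (hPEA : PEA 3 ∉ PromiseBPP') :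
    ∃ D : Ensemble, D.IsPolySamplable ∧ (∀ n : ℕ, ∀ w ∈ (D n).support, w ∈ BPEA.yes ∨ w ∈ BPEA.no) ∧
      (⟨BPEA.yes, D⟩ : DistProblem) ∉ HeurBPP := by
  obtain ⟨kit⟩ := hE
  refine ⟨kit.mix, kit.isPolySamplable_mix, kit.mix_support, fun hmem => hPEA (hD kit ?_)⟩
  exact hA BPEA BPEA_disjoint kit.samp kit.samp_polyTime kit.sampCoins kit.samp_coinLen kit.samp_no
    kit.samp_yes hmem

/-- **The line, arrow form.** The four stub statements imply the unfolded crux: STUB 2 (`BPEA ≤ₚ PEA 3`) and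
the landed push-forward `Theorems.exists_hard_samplable_pea_of_polyTimeReducible` (p71914) carry the hard
samplable on-promise ensemble of `bpea_hard_of_parts` into `PEA 3`.
[DvirGutfreundRothblumVadhan2010, pp. 2–3 and Thm. 4.5; BogdanovTrevisan2006, Lemma 3.2] -/
theorem conclusion_of_parts (hE : ModeEncodingStmt) (hC : CompileStmt) (hA : AdviceElimStmt)
    (hD : DeciderStmt) :
    PEA 3 ∉ PromiseBPP' → ∃ D : Ensemble, D.IsPolySamplable ∧
      (∀ n : ℕ, ∀ w ∈ (D n).support, w ∈ (PEA 3).yes ∨ w ∈ (PEA 3).no) ∧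
      (⟨(PEA 3).yes, D⟩ : DistProblem) ∉ HeurBPP :=
  fun hPEA => exists_hard_samplable_pea_of_polyTimeReducible 3 hC (bpea_hard_of_parts hE hA hD hPEA)

/-- **The skeleton concludes the crux BY NAME**: `Summit.PneNP.PneNP.Theses.SzkEntropy.PeaWorstToAvg` from the
four stubs (named form `Theorems.szkEntropy_peaWorstToAvg_iff`).  `sorry` lives only in the four `stub_*`.
[DvirGutfreundRothblumVadhan2010, pp. 2–3] -/
theorem PeaWorstToAvg_of : Summit.PneNP.PneNP.Theses.SzkEntropy.PeaWorstToAvg :=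
  szkEntropy_peaWorstToAvg_iff.2
    (conclusion_of_parts stub_modeEncoding (stub_compile (stub_blockPerf stub_canon)) stub_adviceElim stub_decider)

/-! ## §5 The socket (reach of the line, sorry-free modulo STUB 2) -/

/-- **Any indistinguishable certified pair of branching-program ensembles closes the crux outright** — and
proves its hypothesis `PEA 3 ∉ PromiseBPP'` (converse `szkEntropy_peaWorstToAvg_converse`).  This is the
card's SOCKET: syntactically lossy/injective logspace families under QR, DDH, DCR or decision-LWE
(Peikert–Waters / FGKRS / MP12-trapdoor-certified modes), the orbit laws of `orbit-pair-rsr`, planted local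
functions — each is a pair `K₀ ⊆ BPEA.no`, `K₁ ⊆ BPEA.yes` of samplable ensembles, and STUB 2 compiles it into
`PEA 3` (landed lever `not_mem_HeurBPP_of_isCompIndistinguishable`, p71078, + push-forward p71914).
[PeikertWaters2008; DvirGutfreundRothblumVadhan2010, pp. 2–3, Thm. 4.5; Goldreich2001, Def. 3.2.2] -/
theorem peaWorstToAvg_of_certifiedPair (hC : CompileStmt) {K₀ K₁ : Ensemble}
    (hK₀ : K₀.IsPolySamplable) (hK₁ : K₁.IsPolySamplable)
    (h₀ : ∀ n : ℕ, ∀ w ∈ (K₀ n).support, w ∈ BPEA.no) (h₁ : ∀ n : ℕ, ∀ w ∈ (K₁ n).support, w ∈ BPEA.yes)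
    (hind : IsCompIndistinguishable K₀ K₁) :
    Summit.PneNP.PneNP.Theses.SzkEntropy.PeaWorstToAvg ∧ PEA 3 ∉ PromiseBPP' :=
  peaWorstToAvg_of_heurHard_reducible
    ⟨BPEA, hC, mixEnsemble K₀ K₁, Ensemble.isPolySamplable_mixEnsemble hK₀ hK₁,
      mixEnsemble_support_subset_promise h₀ h₁,
      not_mem_HeurBPP_of_isCompIndistinguishable BPEA_disjoint h₀ h₁
        (fun n E => by simpa using toOuterMeasure_le_two_mul_mixEnsemble K₀ K₁ n E false)
        (fun n E => by simpa using toOuterMeasure_le_two_mul_mixEnsemble K₀ K₁ n E true) hind⟩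

/-- **Infinitely-often form of the socket**: a samplable certified pair of `BPEA` ensembles that every PPT
distinguisher fails to `9/32`-distinguish at SOME parameter already closes the crux (landed
`not_mem_HeurBPP_of_io_indistinguishable`, p71453) — the quantifier shape worst-case hardness can deliver.
[DvirGutfreundRothblumVadhan2010, pp. 2–3; Goldreich2001, Def. 3.2.2] -/
theorem peaWorstToAvg_of_io_certifiedPair (hC : CompileStmt) {K₀ K₁ : Ensemble}
    (hK₀ : K₀.IsPolySamplable) (hK₁ : K₁.IsPolySamplable)
    (h₀ : ∀ n : ℕ, ∀ w ∈ (K₀ n).support, w ∈ BPEA.no) (h₁ : ∀ n : ℕ, ∀ w ∈ (K₁ n).support, w ∈ BPEA.yes)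
    (hio : ∀ B : RandAlg (List Bool) Bool, IsPPT B encodeBool → ∃ n, distAdvantage B K₀ K₁ n < 9 / 32) :
    Summit.PneNP.PneNP.Theses.SzkEntropy.PeaWorstToAvg ∧ PEA 3 ∉ PromiseBPP' :=
  peaWorstToAvg_of_heurHard_reducible
    ⟨BPEA, hC, mixEnsemble K₀ K₁, Ensemble.isPolySamplable_mixEnsemble hK₀ hK₁,
      mixEnsemble_support_subset_promise h₀ h₁,
      not_mem_HeurBPP_of_io_indistinguishable BPEA_disjoint h₀ h₁
        (fun n E => by simpa using toOuterMeasure_le_two_mul_mixEnsemble K₀ K₁ n E false)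
        (fun n E => by simpa using toOuterMeasure_le_two_mul_mixEnsemble K₀ K₁ n E true) hio⟩

/-- **`PEA 3` itself sits in the socket**: cubic sparse maps ARE affine parity branching programs (a monomial
`x_i x_j x_k` is the path program `i → j → k`, a polynomial the parallel union of its monomials' paths), so a
certified pair of `PEA 3` ensembles is carried to `BPEA` along that embedding — recorded here only in the
degenerate direction the composition needs none of: with `K₀, K₁` already inside `PEA 3` the crux closes by the
landed `peaWorstToAvg_of_dualModePair` (no stub at all). [DvirGutfreundRothblumVadhan2010, Thm. 4.5] -/
theorem peaWorstToAvg_of_peaPair {K₀ K₁ : Ensemble}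
    (hK₀ : K₀.IsPolySamplable) (hK₁ : K₁.IsPolySamplable)
    (h₀ : ∀ n : ℕ, ∀ w ∈ (K₀ n).support, w ∈ (PEA 3).no) (h₁ : ∀ n : ℕ, ∀ w ∈ (K₁ n).support, w ∈ (PEA 3).yes)
    (hind : IsCompIndistinguishable K₀ K₁) :
    Summit.PneNP.PneNP.Theses.SzkEntropy.PeaWorstToAvg ∧ PEA 3 ∉ PromiseBPP' :=
  peaWorstToAvg_of_dualModePair ⟨K₀, K₁, hK₀, hK₁, h₀, h₁, hind⟩

end Summit.PneNP.PneNP.Cruxes.PeaWorstToAvg.DualModeCompile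

end
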